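import Literature.Probability.LatticeModels.CriticalUrsellFourSign
import Literature.Probability.LatticeModels.BackboneChainRule
import Literature.Probability.LatticeModels.IntersectionSecondMoment
import Literature.Probability.LatticeModels.WeightedCurrentsSwitching
import HarnessLib

/-!
# Crux `IsingEuclidUpgradeR4NonGaussian` (stmt-CriticalPhenomena-0636): vocabulary of the line
# `partner-backbone-cut`, and its Stub 2 (exact cut first moment + Cauchy–Schwarz)

Route-posited objects (D-0016 `<Route>Defs`-type file) shared by the registered stubs of the checked
skeleton `Cruxes/IsingEuclidUpgradeR4NonGaussian/Lines/partner-backbone-cut.lean` (crux-plan 2026-08-16,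
line lead prover-line-stmt-CriticalPhenomena-0636-1) and by the crux work file that composes them.
Nothing is asserted here: every declaration is a finite-volume object over tree definitions
(`Current`, `Current.IsSupp`, `Current.connIn`, `Current.eweight`, `ecurrentSum`, `ecurrentSumIn`,
`Current.XState`, `Current.finalStates`, `patSum`, `koff`, `doubleCurrentMeasure`, `tracedConn`,
`currentSum`, `freeBoxGraph`, `BoxVertex`, `latticeApprox`) or a trivial structural lemma about it.

The line (card `Ideas/partner-backbone-cut.md`): in Aizenman's identity
`U₄(x,y,z,t) = -2⟨σ_xσ_y⟩⟨σ_zσ_t⟩ · P^{xy}⊗P^{zt}[x ↔ z in n₁+n₂]` condition on the explored backbone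
`δ` of the partner's `{z,t}`-current; given `δ`, the remainder of that current is an exact sourceless
current on the CUT GRAPH `H_δ = G ∖ δ.used` (chain rule `tsum_sources_inCyl_eq`), and the nested
switching lemma (`Current.etsum_switching_univ`) gives the one-point function of the cluster of `x`
inside `H_δ` in closed form. The objects below are the pieces of the resulting conditional
second-moment bound `P[x ↔ z] ≥ Σ_δ π(δ) E[N_δ|δ]²/E[N_δ²|δ]`.

* §A (finite graph `G`, couplings `K`): `cutGraph`, `contactCount` (`N`), `cutPairWeight` (law of
  `(m, n₁)` given the cut), `cutFirstMoment` (`A`, closed form), `fullFirstMoment` (`A⁺`, shadow-free),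
  `cutSecondMoment` (`B`, the TRUE second moment), `cutContactMass` (`Σ W 1[N ≥ 1]`),
  `backboneCutRatio` (`A²/B`), `roughStates` / `roughMass` / `roughRatioMass` (backbone states whose
  helper-assisted contact mean is `≥ M`), `connMass` (`P[x↔z]·Z[xy]Z[zt]`).
* §B (lattice side, `ℤ³`): `boxPt`, `meshPt` (the points `[X_i/δ]` read in `BoxVertex 3 L`),
  `canonicalRanking` (an injective ranking of the bonds of the free box graph).
* §C the registered stub `stub_cutContactSecondMoment` (Stub 2 of the line, PROVED here, it is a
  property of the §A vocabulary alone): `Σ W·N = A` exactly by the nested switching lemma on the cut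
  graph (`tsum_cutPairWeight_mul_indicator_connIn`, `tsum_cutPairWeight_mul_contactCount`), hence
  `A² ≤ (Σ W 1[N ≥ 1])·(Σ W N²)` by the weighted Cauchy–Schwarz inequality
  `Current.tsum_mul_sq_le_tsum_indicator_mul_tsum_sq`.

Deliberately NOT here: the line's bare `Prop` statements (`BackboneCutDecomposition`,
`CutContactSecondMoment`, `PartnerBackboneRough`, `BackboneShadowBound`) — they live in the skeleton, and
the registered stubs are their explicit `∀`-forms over this vocabulary.

References: M. Aizenman, Comm. Math. Phys. 86 (1982) §9 (the backbone exploration);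
M. Aizenman, H. Duminil-Copin, V. Sidoravicius, Comm. Math. Phys. 334 (2015) Lemma 2.2 (nested
switching); M. Aizenman, H. Duminil-Copin, Ann. Math. 194 (2021) = arXiv:1912.07973, §3 (3.11),
§4.2 Lemma 4.4, App. A (second-moment pattern).
-/

noncomputable section

namespace Summit.CriticalPhenomena.Ising3DConformalLimit.Cruxes.IsingEuclidUpgradeR4NonGaussian.PartnerBackboneCut

open Literature.Probability Literature.Probability.LatticeModels Literature.Probability.Percolation
open MeasureTheory Filter Finset
open scoped Topology symmDiff ENNReal

/-! ## §A. Finite-volume objects of the backbone-cut decomposition -/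

section FiniteVolume

variable {V : Type*} [Fintype V] [DecidableEq V] (G : SimpleGraph V) [DecidableRel G.Adj]

/-- **The cut graph** `H_D = G ∖ D`: the graph `G` with the bonds of `D` deleted (same vertex type).
For `D = δ.used`, the examined bonds of the exploration `δ` of the partner's current, this is the graph
on which — conditionally on `δ` — the remainder of that current is an exact sourceless current with the
original couplings (`tsum_sources_inCyl_eq`: couplings `koff K δ.used`).
(Aizenman 1982 §9; Aizenman–Duminil-Copin–Sidoravicius 2015 Lemma 2.2.) [cite: AizenmanCMP1982, §9] -/
def cutGraph (D : Finset G.edgeFinset) : SimpleGraph V where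
  Adj a b := G.Adj a b ∧ s(a, b) ∉ D.image (fun e : G.edgeFinset => (e : Sym2 V))
  symm := ⟨fun a b h => ⟨h.1.symm, by rw [Sym2.eq_swap]; exact h.2⟩⟩
  loopless := ⟨fun a h => G.loopless.irrefl a h.1⟩

/-- Adjacency in the cut graph: adjacent in `G` and the bond is not deleted. [folklore] -/
theorem cutGraph_adj {D : Finset G.edgeFinset} {a b : V} :
    (cutGraph G D).Adj a b ↔ G.Adj a b ∧ s(a, b) ∉ D.image (fun e : G.edgeFinset => (e : Sym2 V)) :=
  Iff.rfl

/-- The cut graph is a subgraph of `G`. [folklore] -/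
theorem cutGraph_le (D : Finset G.edgeFinset) : cutGraph G D ≤ G :=
  fun _ _ h => h.1

/-- Deleting no bond gives back `G`. [folklore] -/
theorem cutGraph_empty : cutGraph G (∅ : Finset G.edgeFinset) = G := by
  ext a b
  simp [cutGraph_adj]

/-- Adjacency in the cut graph is decidable. [folklore] -/
instance instDecidableRelCutGraphAdj (D : Finset G.edgeFinset) : DecidableRel (cutGraph G D).Adj :=
  fun a b => decidable_of_iff (G.Adj a b ∧ s(a, b) ∉ D.image (fun e : G.edgeFinset => (e : Sym2 V)))
    (cutGraph_adj G).symm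

/-- **Contact count** `N = #{u ∈ S : x ↔ u inside H_D}` of a current `m` (applied to `m + n₁`): the
number of sites of `S` (the backbone `δ.vis`) joined to `x` through bonds of the cut graph carrying
positive current (`Current.connIn (cutGraph G D) x u`). Each contact forces `x ↔ z` in the full trace.
(Card `partner-backbone-cut`, §Mechanism.) [folklore] -/
def contactCount (D : Finset G.edgeFinset) (S : Finset V) (x : V) (m : Current G) : ℝ≥0∞ :=
  ∑ u ∈ S, (Current.connIn (cutGraph G D) x u).indicator 1 m

variable {G}

/-- **The conditional pair weight given the backbone** (un-normalised law of `(m, n₁)` given `δ`):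
`1{m ⊆ E(H_D), ∂m = ∅} w_K(m) · 1{∂n₁ = {x}Δ{y}} w_K(n₁)` — exactly the shape of the left side of the
tree's nested switching lemma `Current.etsum_switching_univ (cutGraph G D)`.
(Aizenman–Duminil-Copin–Sidoravicius 2015, Lemma 2.2.) [cite: AizenmanDuminilCopinSidoraviciusCMP2015, Lemma 2.2] -/
def cutPairWeight (K : G.edgeFinset → ℝ) (D : Finset G.edgeFinset) (x y : V)
    (p : Current G × Current G) : ℝ≥0∞ :=
  (if Current.IsSupp (cutGraph G D) p.1 ∧ p.1.sources = ∅ then p.1.eweight K else 0) *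
    (if p.2.sources = {x} ∆ {y} then p.2.eweight K else 0)

/-- **The exact conditional first moment, closed form**: `A = Σ_{u ∈ S} Z_{H_D}[{x}Δ{u}] · Z_G[{y}Δ{u}]`
(`= Σ W·N` by nested switching; normalised: `E[N | δ] = Σ_u ⟨σ_xσ_u⟩_{H_δ}⟨σ_uσ_y⟩_G/⟨σ_xσ_y⟩_G`,
the cut one-point density of the card; `⟨σ_xσ_u⟩_{H_δ}/⟨σ_xσ_u⟩_G ∈ (0,1]` is the SHADOW factor).
(Aizenman–Duminil-Copin–Sidoravicius 2015, Lemma 2.2.) [cite: AizenmanDuminilCopinSidoraviciusCMP2015, Lemma 2.2] -/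
def cutFirstMoment (K : G.edgeFinset → ℝ) (D : Finset G.edgeFinset) (S : Finset V) (x y : V) : ℝ≥0∞ :=
  ∑ u ∈ S, ecurrentSumIn (cutGraph G D) K ({x} ∆ {u}) * ecurrentSum K ({y} ∆ {u})

/-- **The helper-assisted (shadow-free) first moment** `A⁺ = Σ_{u ∈ S} Z_G[{x}Δ{u}] · Z_G[{y}Δ{u}]`:
normalised by `Z[xy]Z[∅]` it is `E^{xy,∅}[#(S ∩ C(x))]` on the FULL graph, the `σσ`-capacity of `S`
seen from `x, y`; `A ≤ A⁺` (GKS). (Aizenman–Duminil-Copin 2021, App. A.) [cite: AizenmanDuminilCopinAnnals2021, App. A] -/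
def fullFirstMoment (K : G.edgeFinset → ℝ) (S : Finset V) (x y : V) : ℝ≥0∞ :=
  ∑ u ∈ S, ecurrentSum K ({x} ∆ {u}) * ecurrentSum K ({y} ∆ {u})

/-- **The TRUE conditional second moment** (un-normalised) `B = Σ W·N²` — deliberately NOT replaced by a
closed-form upper bound. (Aizenman–Duminil-Copin 2021, §4.2 Lemma 4.4 pattern.) [cite: AizenmanDuminilCopinAnnals2021, §4.2 Lemma 4.4] -/
def cutSecondMoment (K : G.edgeFinset → ℝ) (D : Finset G.edgeFinset) (S : Finset V) (x y : V) : ℝ≥0∞ :=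
  ∑' p : Current G × Current G, cutPairWeight K D x y p * contactCount G D S x (p.1 + p.2) ^ 2

/-- **The contact mass** `Σ W·1[N ≥ 1]` (un-normalised `P[N_δ ≥ 1 | δ]`).
(Card `partner-backbone-cut`.) [folklore] -/
def cutContactMass (K : G.edgeFinset → ℝ) (D : Finset G.edgeFinset) (S : Finset V) (x y : V) : ℝ≥0∞ :=
  ∑' p : Current G × Current G,
    cutPairWeight K D x y p * (if contactCount G D S x (p.1 + p.2) = 0 then 0 else 1)

/-- **The Cauchy–Schwarz ratio of a backbone state** `A(δ)²/B(δ)` (cut `δ.used`, targets `δ.vis`).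
ENNReal conventions `0/0 = 0`, `a/⊤ = 0` are harmless for a lower bound. [folklore] -/
def backboneCutRatio (K : G.edgeFinset → ℝ) (x y : V) (δ : Current.XState G) : ℝ≥0∞ :=
  cutFirstMoment K δ.used δ.vis x y ^ 2 / cutSecondMoment K δ.used δ.vis x y

/-- **`M`-rough backbone states**: final states `δ` of the exploration of the `{z,t}`-current from `z`
(tree `Current.finalStates rk {t} z t`) whose helper-assisted contact mean from `x, y` is at least `M`:
`A⁺(δ) ≥ M · Z[xy] · Z[∅]`, i.e. `E^{xy,∅}[#(δ.vis ∩ C(x))] ≥ M`. [folklore] -/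
def roughStates (K : G.edgeFinset → ℝ) (rk : G.edgeFinset → ℕ) (M : ℝ) (x y z t : V) :
    Finset (Current.XState G) :=
  (Current.finalStates rk {t} z t).filter fun δ =>
    ENNReal.ofReal M * (ecurrentSum K ({x} ∆ {y}) * ecurrentSum K ∅) ≤ fullFirstMoment K δ.vis x y

/-- **Mass of the `M`-rough backbones**: `Σ_{δ rough} patSum(δ)·Z_{K off δ.used}[∅]`; divided by `Z[zt]`
(`= Σ_{all δ} patSum·Z_off[∅]`, chain rule) this is `P^{zt}[the backbone is M-rough]`. [folklore] -/
def roughMass (K : G.edgeFinset → ℝ) (rk : G.edgeFinset → ℕ) (M : ℝ) (x y z t : V) : ℝ≥0∞ :=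
  ∑ δ ∈ roughStates K rk M x y z t, patSum K δ * ecurrentSum (koff K δ.used) ∅

/-- **The Cauchy–Schwarz ratio integrated over `M`-rough backbones**: `Σ_{δ rough} patSum(δ)·A(δ)²/B(δ)`.
[folklore] -/
def roughRatioMass (K : G.edgeFinset → ℝ) (rk : G.edgeFinset → ℕ) (M : ℝ) (x y z t : V) : ℝ≥0∞ :=
  ∑ δ ∈ roughStates K rk M x y z t, patSum K δ * backboneCutRatio K x y δ

variable (G) in
/-- **The connection mass** `P^{{x}Δ{y},{z}Δ{t}}_{G,β}[x ↔ z in n₁+n₂] · Z[{x}Δ{y}] · Z[{z}Δ{t}]`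
(`= Σ 1{∂n₁={x}Δ{y}}1{∂n₂={z}Δ{t}} w w 1[x ↔ z]` by `doubleCurrentMeasure_real_mul'`), uniform
coupling `β`: the quantity `-U₄ · Z[∅]²/2` of the box identity `connectedFour_free_box_eq'`.
(Aizenman 1982 Prop. 5.1; Aizenman–Duminil-Copin 2021 (3.11).) [cite: AizenmanDuminilCopinAnnals2021, §3 (3.11)] -/
def connMass (β : ℝ) (x y z t : V) : ℝ≥0∞ :=
  ENNReal.ofReal ((doubleCurrentMeasure G β ({x} ∆ {y}) ({z} ∆ {t})).real (tracedConn G x z) *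
    (currentSum G β ({x} ∆ {y}) * currentSum G β ({z} ∆ {t})))

/-- The rough ratio mass is a sub-sum of the full Cauchy–Schwarz sum over all final states. [folklore] -/
theorem roughRatioMass_le_sum (K : G.edgeFinset → ℝ) (rk : G.edgeFinset → ℕ) (M : ℝ) (x y z t : V) :
    roughRatioMass K rk M x y z t ≤
      ∑ δ ∈ Current.finalStates rk {t} z t, patSum K δ * backboneCutRatio K x y δ := by
  unfold roughRatioMass roughStates
  exact Finset.sum_le_sum_of_subset (Finset.filter_subset _ _)

/-- The rough mass is at most the total mass `Σ_{all δ} patSum·Z_off[∅]` of the final states. [folklore] -/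
theorem roughMass_le_sum (K : G.edgeFinset → ℝ) (rk : G.edgeFinset → ℕ) (M : ℝ) (x y z t : V) :
    roughMass K rk M x y z t ≤
      ∑ δ ∈ Current.finalStates rk {t} z t, patSum K δ * ecurrentSum (koff K δ.used) ∅ := by
  unfold roughMass roughStates
  exact Finset.sum_le_sum_of_subset (Finset.filter_subset _ _)

end FiniteVolume

/-! ## §B. Lattice side: points of a configuration inside the box graphs of `ℤ³` -/

/-- A site of `ℤ³` read in the vertex type `BoxVertex 3 L = ↥Λ_{L+1}` (junk: the origin, when
`v ∉ Λ_{L+1}`; never used at such `v`). [folklore] -/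
def boxPt (L : ℕ) (v : Site 3) : BoxVertex 3 L :=
  if h : v ∈ LatticeModels.box 3 (L + 1) then ⟨v, h⟩ else ⟨0, LatticeModels.zero_mem_box 3 (L + 1)⟩

/-- `boxPt` is the inclusion on `Λ_{L+1}`. [folklore] -/
theorem coe_boxPt {L : ℕ} {v : Site 3} (h : v ∈ LatticeModels.box 3 (L + 1)) :
    (boxPt L v : Site 3) = v := by
  unfold boxPt; rw [dif_pos h]

/-- The lattice points `[X_i/δ]` of a configuration `X`, in the box vertex type. [folklore] -/
def meshPt (L : ℕ) (δ : ℝ) (X : Fin 4 → EuclideanSpace ℝ (Fin 3)) (i : Fin 4) : BoxVertex 3 L :=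
  boxPt L (latticeApprox δ (X i))

/-- Eventually (as `L → ∞`) the four lattice points of `X` at mesh `δ` lie in `Λ_L`. [folklore] -/
theorem eventually_forall_latticeApprox_mem_box (δ : ℝ) (X : Fin 4 → EuclideanSpace ℝ (Fin 3)) :
    ∀ᶠ L : ℕ in atTop, ∀ i, latticeApprox δ (X i) ∈ LatticeModels.box 3 L := by
  classical
  obtain ⟨L₀, hL₀⟩ := exists_forall_subset_box 3 (Finset.univ.image fun i => latticeApprox δ (X i))
  filter_upwards [eventually_ge_atTop L₀] with L hL i
  exact hL₀ L hL (Finset.mem_image_of_mem _ (Finset.mem_univ i))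

/-- A canonical injective ranking of the bonds of the free box graph (the open stubs hold for every
injective ranking; the composition uses this one). [folklore] -/
def canonicalRanking (L : ℕ) : (freeBoxGraph 3 L).edgeFinset → ℕ :=
  fun e => (Fintype.equivFin ((freeBoxGraph 3 L).edgeFinset) e : ℕ)

/-- The canonical ranking is injective. [folklore] -/
theorem canonicalRanking_injective (L : ℕ) : Function.Injective (canonicalRanking L) :=
  fun _ _ h => (Fintype.equivFin _).injective (Fin.ext h)

/-! ## §C. The cut one-point function is exact ⇒ Cauchy–Schwarz lower bound for contact
(registered stub `stub_cutContactSecondMoment` of the line; a property of the §A vocabulary) -/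

section CutContact

variable {V : Type*} [Fintype V] [DecidableEq V] {G : SimpleGraph V} [DecidableRel G.Adj]

/-- **The cut one-point function, un-normalised** (nested switching lemma on the cut graph):
`Σ_{(m,n₁)} 1{m ⊆ E(H_D), ∂m = ∅} w(m) 1{∂n₁ = {x}Δ{y}} w(n₁) 1[x ↔ u in H_D through m+n₁]
 = Z_{H_D}[{x}Δ{u}] · Z_G[{y}Δ{u}]`, i.e. `P[x ↔ u in H_D | cut] = ⟨σ_xσ_u⟩_{H_D}⟨σ_uσ_y⟩_G/⟨σ_xσ_y⟩_G`.
[cite: AizenmanDuminilCopinSidoraviciusCMP2015, Lemma 2.2] -/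
theorem tsum_cutPairWeight_mul_indicator_connIn {K : G.edgeFinset → ℝ} (hK : ∀ e, 0 ≤ K e)
    (D : Finset G.edgeFinset) (x y u : V) :
    ∑' p : Current G × Current G,
        cutPairWeight K D x y p * (Current.connIn (cutGraph G D) x u).indicator 1 (p.1 + p.2) =
      ecurrentSumIn (cutGraph G D) K ({x} ∆ {u}) * ecurrentSum K ({y} ∆ {u}) := by
  have hsw := Current.etsum_switching_univ (G := G) (cutGraph G D) hK ∅ ({x} ∆ {y}) x u (fun _ => 1)
  have hA : (∅ : Finset V) ∆ ({x} ∆ {u}) = {x} ∆ {u} := bot_symmDiff _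
  have hB : ({x} ∆ {y}) ∆ ({x} ∆ {u}) = ({y} ∆ {u} : Finset V) := by
    rw [symmDiff_comm ({x} : Finset V) {y}, symmDiff_assoc, symmDiff_symmDiff_cancel_left]
  rw [hA, hB] at hsw
  calc ∑' p : Current G × Current G,
        cutPairWeight K D x y p * (Current.connIn (cutGraph G D) x u).indicator 1 (p.1 + p.2)
      = ∑' p : Current G × Current G,
          (if Current.IsSupp (cutGraph G D) p.1 ∧ p.1.sources = ∅ then p.1.eweight K else 0) *
            (if p.2.sources = {x} ∆ {y} then p.2.eweight K else 0) *
            ((fun _ => (1 : ℝ≥0∞)) (p.1 + p.2) *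
              (Current.connIn (cutGraph G D) x u).indicator 1 (p.1 + p.2)) := by
        refine tsum_congr fun p => ?_
        simp only [cutPairWeight, one_mul]
    _ = ∑' p : Current G × Current G,
          (if Current.IsSupp (cutGraph G D) p.1 ∧ p.1.sources = {x} ∆ {u} then p.1.eweight K else 0) *
            (if p.2.sources = {y} ∆ {u} then p.2.eweight K else 0) *
            ((fun _ => (1 : ℝ≥0∞)) (p.1 + p.2) *
              (Current.connIn (cutGraph G D) x u).indicator 1 (p.1 + p.2)) := hsw
    _ = ∑' p : Current G × Current G,
          (if Current.IsSupp (cutGraph G D) p.1 ∧ p.1.sources = {x} ∆ {u} then p.1.eweight K else 0) *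
            (if p.2.sources = {y} ∆ {u} then p.2.eweight K else 0) := by
        refine tsum_congr fun p => ?_
        by_cases h : Current.IsSupp (cutGraph G D) p.1 ∧ p.1.sources = {x} ∆ {u}
        · have hmem : p.1 + p.2 ∈ Current.connIn (cutGraph G D) x u :=
            Current.add_mem_connIn_of_sources_eq (cutGraph G D) h.1 h.2 p.2
          simp only [Set.indicator_of_mem hmem, Pi.one_apply, mul_one]
        · simp only [if_neg h, zero_mul]
    _ = ecurrentSumIn (cutGraph G D) K ({x} ∆ {u}) * ecurrentSum K ({y} ∆ {u}) :=
        (Current.ecurrentSumIn_mul_ecurrentSum (cutGraph G D) ({x} ∆ {u}) ({y} ∆ {u})).symm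

/-- **The conditional first moment is exact**: `Σ W·N = A`, i.e.
`Σ_{(m,n₁)} cutPairWeight · contactCount(m+n₁) = cutFirstMoment K D S x y`
(Fubini over `u ∈ S` and `tsum_cutPairWeight_mul_indicator_connIn`).
[cite: AizenmanDuminilCopinSidoraviciusCMP2015, Lemma 2.2] -/
theorem tsum_cutPairWeight_mul_contactCount {K : G.edgeFinset → ℝ} (hK : ∀ e, 0 ≤ K e)
    (D : Finset G.edgeFinset) (S : Finset V) (x y : V) :
    ∑' p : Current G × Current G, cutPairWeight K D x y p * contactCount G D S x (p.1 + p.2) =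
      cutFirstMoment K D S x y := by
  unfold contactCount cutFirstMoment
  simp only [Finset.mul_sum]
  rw [Summable.tsum_finsetSum (fun _ _ => ENNReal.summable)]
  exact Finset.sum_congr rfl fun u _ => tsum_cutPairWeight_mul_indicator_connIn hK D x y u

/-- **Stub 2 of the line `partner-backbone-cut` — exact cut first moment + Cauchy–Schwarz**:
for every finite graph, couplings `K ≥ 0`, cut `D`, target set `S`, vertices `x y`,
`(cutFirstMoment K D S x y)² ≤ cutContactMass K D S x y · cutSecondMoment K D S x y`, i.e.
`P[N ≥ 1 | cut] ≥ E[N | cut]² / E[N² | cut]` with the first moment in closed form.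
(Aizenman–Duminil-Copin 2021, §4.2, proof of Lemma 4.4: the second-moment inequality; the first
moment by Aizenman–Duminil-Copin–Sidoravicius 2015, Lemma 2.2.)
[cite: AizenmanDuminilCopinAnnals2021, arXiv:1912.07973 §4.2 Lemma 4.4] -/
theorem stub_cutContactSecondMoment :
    ∀ (V : Type) [Fintype V] [DecidableEq V] (G : SimpleGraph V) [DecidableRel G.Adj]
      (K : G.edgeFinset → ℝ), (∀ e, 0 ≤ K e) → ∀ (D : Finset G.edgeFinset) (S : Finset V) (x y : V),
        cutFirstMoment K D S x y ^ 2 ≤ cutContactMass K D S x y * cutSecondMoment K D S x y := by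
  intro V _ _ G _ K hK D S x y
  rw [← tsum_cutPairWeight_mul_contactCount hK D S x y]
  exact Current.tsum_mul_sq_le_tsum_indicator_mul_tsum_sq (cutPairWeight K D x y)
    (fun p => contactCount G D S x (p.1 + p.2))

end CutContact

end Summit.CriticalPhenomena.Ising3DConformalLimit.Cruxes.IsingEuclidUpgradeR4NonGaussian.PartnerBackboneCut
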